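import Mathlib
import Summits.ValiantsHypothesis.ValiantsHypothesis.Theorems.FreeSubtorusOrbitDimensionBoundSignCoveringPrelim
import Literature.Computability.AlgebraicComplexity.ApolarityFischerPairing

/-!
# `OrbitDimensionBound` (stmt-ValiantsHypothesis-16133), rung line `sign_covering` — stub `stub_signDiagonalise`

The line `Cruxes/OrbitDimensionBound/Lines/sign_covering.lean` (route `FreeSubtorus`, rung `Torsion.SignShadow`,
2026-08-18) reduces the sign-equivariant covering bound `SignCovering` to four registered stubs:
`stub_perSummand` (Krull–Schmidt), `stub_signLinearise` (homomorphic lifts of the sign group), `stub_signDiagonalise`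
(sign-graded normal form) and the load-bearing count `stub_signCount`.  This file proves the THIRD one,

  `stub_signDiagonalise : Stmt.stub_signDiagonalise`,

with the line's vocabulary (`SignVec`, `pair`, `signRel`, `sgn`, `signElem`, `varVec`, `IsLinearLift`, `IsSignGraded`)
UNFOLDED in the statement (no definitions are introduced here; the skeleton's `sorry` closes by
`exact SignCovering.stub_signDiagonalise`, checked against a verbatim copy of the line's §0–§1).

**Statement.**  Let `S_Λ = {s ∈ 𝔽₂^{[n] ⊔ [n]} | Λ̄ s = 0}` be the sign group, acting on the variables by
`γ_s · x_{kl} = (-1)^{s(inl k) + s(inr l)} x_{kl}`, and let `ρ₁, ρ₂ : 𝔽₂^{[n] ⊔ [n]} → GL_m(ℂ)` be multiplicative on `S_Λ`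
with `B(γ_s · x) = ρ₁(s) · B · ρ₂(s)⁻¹` for all `s ∈ S_Λ` (a HOMOMORPHIC lift), where `B` is an `m × m` matrix of affine
forms.  Then there are `P, Q ∈ GL_m(ℂ)` and grades `α, β : [m] → 𝔽₂^{[n] ⊔ [n]}` such that every entry of `P · B · Q` is
`C a₀ + Σ_p a_p X_p` with `a₀ ≠ 0 ⇒ ⟨β_i − α_j, s⟩ = 0` and `a_p ≠ 0 ⇒ ⟨β_i − α_j − varVec p, s⟩ = 0` for all `s ∈ S_Λ`.

**Proof** (linear algebra in `Theorems/FreeSubtorusOrbitDimensionBoundSignCoveringPrelim.lean`).  On `S_Λ` each `ρ_k` takes values in pairwise COMMUTING INVOLUTIONS (`ρ(s)² = ρ(s + s) = ρ(0) = 1`);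
a commuting family of involutions of `ℂ^m` has a joint eigenbasis (Mathlib: simultaneous triangularisation
`Module.End.iSup_iInf_maxGenEigenspace_eq_top_of_iSup_maxGenEigenspace_eq_top_of_commute`, and for an involution —
semisimple since `X² − 1` is squarefree — generalised eigenvectors are eigenvectors), which we package as mutually
inverse matrices `P, P'` with `ρ(s) = P · diag(χ_i(s)) · P'`, `χ_i(s) = ±1` (`exists_jointSignBasis`).
Each `χ_i` is a character of the elementary abelian `2`-group `S_Λ`, i.e. an `𝔽₂`-linear functional on the
subspace `S_Λ ≤ 𝔽₂^{[n] ⊔ [n]}`; it extends to the whole space (`LinearMap.exists_extend`) and is therefore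
`s ↦ (-1)^{⟨β_i, s⟩}` for a representative `β_i` (`exists_functional_of_character`).  Conjugating the lift
equation by the two base changes gives `B'(γ_s · x)_{ij} = χ¹_i(s) χ²_j(s) · B'_{ij}` for `B' = P₁' · B · P₂`
(`linSubst_conj_entry`), while `γ_s` multiplies the coefficient of `X_p` by `(-1)^{s(inl p₁) + s(inr p₂)}` and fixes
the constant term (tree `coeff_linSubst_diagonal`); comparing coefficients of the affine entry (§1 here) yields the two
support clauses, using that `a ↦ (-1)^a` is an injective character of `𝔽₂`.

Helper mode (`--supports stmt-ValiantsHypothesis-16133 --as helper`): the line `sign_covering` is not the registered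
skeleton of the item (that is `affine_multiple`), so no stub credit moves.  Honest framing: a bookkeeping stub
([folklore] linear algebra) of a dormant rung line whose cores `stub_signLinearise` (L) and `stub_signCount` (L+)
remain OPEN; the crux `OrbitDimensionBound`, the route `FreeSubtorus` and VP ≠ VNP are OPEN and NOT moved by this file.

## References
* [LandsbergRessayre2017] J. M. Landsberg, N. Ressayre, *Permanent v. determinant: an exponential lower bound assuming
  symmetry and a potential path towards Valiant's conjecture*, Differential Geom. Appl. 55 (2017), §6 (sign groups
  `T_Λ[2]` and graded normal forms).
* A. Borel, *Linear Algebraic Groups*, 2nd ed., GTM 126 (1991), §4.2, Prop. 4.6 (commuting semisimple families are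
  simultaneously diagonalisable).
-/

set_option linter.dupNamespace false

namespace Summit.ValiantsHypothesis.ValiantsHypothesis.Theorems.FreeSubtorusOrbitDimensionBound.SignCovering

open Matrix MvPolynomial
open Literature.Computability.AlgebraicComplexity

/-! ### §1 Affine entries under diagonal substitutions -/

section Affine

variable {σ : Type*} [Fintype σ] [DecidableEq σ]

omit [Fintype σ] in
/-- A nonzero exponent of weight `≤ 1` is a unit vector `e_v`. [folklore] -/
theorem exists_single_eq_of_sum_le_one {d : σ →₀ ℕ} (h0 : d ≠ 0) (hdeg : d.sum (fun _ e => e) ≤ 1) :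
    ∃ v, Finsupp.single v 1 = d := by
  classical
  have hne : d.support.Nonempty := Finsupp.support_nonempty_iff.mpr h0
  obtain ⟨v, hv⟩ := hne
  have hv1 : 1 ≤ d v := Nat.one_le_iff_ne_zero.mpr (Finsupp.mem_support_iff.mp hv)
  have hsum : d.sum (fun _ e => e) = ∑ x ∈ d.support, d x := rfl
  have hle : ∀ w ∈ d.support, w ≠ v → d v + d w ≤ ∑ x ∈ d.support, d x := by
    intro w hw hwv
    rw [← Finset.sum_pair (Ne.symm hwv)]
    refine Finset.sum_le_sum_of_subset_of_nonneg ?_ (fun _ _ _ => Nat.zero_le _)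
    intro x hx
    simp only [Finset.mem_insert, Finset.mem_singleton] at hx
    rcases hx with rfl | rfl
    · exact hv
    · exact hw
  refine ⟨v, ?_⟩
  ext w
  by_cases hw : w = v
  · subst hw
    rw [Finsupp.single_eq_same]
    have : d w ≤ 1 := le_trans (by rw [hsum]; exact Finset.single_le_sum (fun _ _ => Nat.zero_le _) hv) hdeg
    omega
  · rw [Finsupp.single_apply, if_neg (Ne.symm hw)]
    by_contra hw0
    have hw' : w ∈ d.support := Finsupp.mem_support_iff.mpr (Ne.symm hw0)
    have h1 : 1 ≤ d w := Nat.one_le_iff_ne_zero.mpr (Finsupp.mem_support_iff.mp hw')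
    have := hle w hw' hw
    rw [← hsum] at this
    omega

/-- Affine expansion: a polynomial of total degree `≤ 1` is `C (coeff 0 p) + Σ_v (coeff e_v p) • X_v`. [folklore] -/
theorem eq_C_add_sum_smul_X_of_totalDegree_le_one {p : MvPolynomial σ ℂ} (hp : p.totalDegree ≤ 1) :
    p = C (coeff 0 p) + ∑ v, coeff (Finsupp.single v 1) p • X v := by
  classical
  apply MvPolynomial.ext
  intro d
  rw [coeff_add, coeff_C, coeff_sum]
  simp_rw [coeff_smul, coeff_X, smul_eq_mul]
  by_cases h0 : d = 0
  · subst h0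
    rw [if_pos rfl, Finset.sum_eq_zero, add_zero]
    intro v _
    rw [if_neg (Finsupp.single_ne_zero.mpr one_ne_zero), mul_zero]
  rw [if_neg (Ne.symm h0), zero_add]
  by_cases h1 : ∃ v, Finsupp.single v 1 = d
  · obtain ⟨v, rfl⟩ := h1
    rw [Finset.sum_eq_single v, if_pos rfl, mul_one]
    · intro w _ hw
      rw [if_neg (fun h => hw (Finsupp.single_left_injective one_ne_zero h)), mul_zero]
    · intro hv
      exact absurd (Finset.mem_univ v) hv
  · have hsum : ∑ v, coeff (Finsupp.single v 1) p * (if Finsupp.single v 1 = d then (1 : ℂ) else 0) = 0 :=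
      Finset.sum_eq_zero fun v _ => by rw [if_neg (fun h => h1 ⟨v, h⟩), mul_zero]
    rw [hsum]
    by_contra hd
    have hdeg : d.sum (fun _ e => e) ≤ 1 := (le_totalDegree (mem_support_iff.mpr hd)).trans hp
    exact h1 (exists_single_eq_of_sum_le_one h0 hdeg)

omit [Fintype σ] [DecidableEq σ] in
/-- Entries of `P · B · Q` for CONSTANT `P, Q` have total degree `≤ 1` when those of `B` do. [folklore] -/
theorem totalDegree_conj_le_one {m : ℕ} (P Q : Matrix (Fin m) (Fin m) ℂ)
    (B : Matrix (Fin m) (Fin m) (MvPolynomial σ ℂ)) (hB : ∀ i j, (B i j).totalDegree ≤ 1) (i j : Fin m) :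
    ((P.map C * B * Q.map C : Matrix (Fin m) (Fin m) (MvPolynomial σ ℂ)) i j).totalDegree ≤ 1 := by
  rw [Matrix.mul_apply]
  refine (totalDegree_finsetSum _ _).trans (Finset.sup_le fun l _ => ?_)
  rw [Matrix.mul_apply, Finset.sum_mul]
  refine (totalDegree_finsetSum _ _).trans (Finset.sup_le fun k _ => ?_)
  simp only [Matrix.map_apply]
  calc (C (P i k) * B k l * C (Q l j)).totalDegree
      ≤ (C (P i k) * B k l).totalDegree + (C (Q l j)).totalDegree := totalDegree_mul _ _
    _ ≤ ((C (P i k)).totalDegree + (B k l).totalDegree) + (C (Q l j)).totalDegree :=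
        Nat.add_le_add_right (totalDegree_mul _ _) _
    _ ≤ 1 := by simp [totalDegree_C, hB k l]

/-- Coefficientwise action of a diagonal substitution on an affine form: the constant term is fixed and the
coefficient of `X_v` is multiplied by `c_v`. [folklore] -/
theorem coeff_zero_linSubst_diagonal (c : σ → ℂ) (q : MvPolynomial σ ℂ) :
    coeff 0 (linSubst σ ℂ (Matrix.diagonal c) q) = coeff 0 q := by
  rw [coeff_linSubst_diagonal]
  simp

/-- Coefficient of `X_v` under a diagonal substitution: multiplied by `c_v`. [folklore] -/
theorem coeff_single_linSubst_diagonal (c : σ → ℂ) (q : MvPolynomial σ ℂ) (v : σ) :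
    coeff (Finsupp.single v 1) (linSubst σ ℂ (Matrix.diagonal c) q) = c v * coeff (Finsupp.single v 1) q := by
  rw [coeff_linSubst_diagonal, Finsupp.support_single _ one_ne_zero]
  simp

end Affine

/-! ### §2 The stub -/

section Main

/-- The pairing `Σ_x w_x s_x` is additive in `w`. [folklore] -/
theorem pair_add {X : Type*} [Fintype X] (u v s : X → ZMod 2) :
    ∑ x, (u + v) x * s x = ∑ x, u x * s x + ∑ x, v x * s x := by
  rw [← Finset.sum_add_distrib]
  refine Finset.sum_congr rfl fun x _ => ?_
  rw [Pi.add_apply, add_mul]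

/-- In characteristic `2` the pairing turns `−` into `+`. [folklore] -/
theorem pair_sub {X : Type*} [Fintype X] (u v s : X → ZMod 2) :
    ∑ x, (u - v) x * s x = ∑ x, u x * s x + ∑ x, v x * s x := by
  rw [← pair_add]
  refine Finset.sum_congr rfl fun x _ => ?_
  have hsub : ∀ a b : ZMod 2, a - b = a + b := by decide
  rw [Pi.sub_apply, Pi.add_apply, hsub]

/-- The character of the variable `x_{kl}` pairs a sign vector to `s(inl k) + s(inr l)`. [folklore] -/
theorem pair_varVec {n : ℕ} (p : Fin n × Fin n) (s : (Fin n ⊕ Fin n) → ZMod 2) :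
    ∑ x, (fun x => Sum.elim (fun k => if k = p.1 then (1 : ZMod 2) else 0)
        (fun l => if l = p.2 then (1 : ZMod 2) else 0) x) x * s x =
      s (Sum.inl p.1) + s (Sum.inr p.2) := by
  rw [Fintype.sum_sum_type]
  simp only [Sum.elim_inl, Sum.elim_inr, ite_mul, one_mul, zero_mul, Finset.sum_ite_eq', Finset.mem_univ,
    if_true]

/-- **Stub `stub_signDiagonalise` of the line `sign_covering`** (statement = the line's `Stmt.stub_signDiagonalise` with
`SignVec`, `pair`, `signRel`, `sgn`, `signElem`, `varVec`, `IsLinearLift`, `IsSignGraded` unfolded): a HOMOMORPHIC lift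
`ρ₁, ρ₂` of the elementary abelian `2`-group `S_Λ` puts an affine matrix `B`, after ONE constant base change `(P, Q)`, in
SIGN-GRADED form — every entry of `P·B·Q` is `C a₀ + Σ_p a_p X_p` with `a₀` supported on `β_i − α_j ⊥ S_Λ` and `a_p`
supported on `β_i − α_j − varVec p ⊥ S_Λ`.  Proof: `ρ_k(S_Λ)` are commuting involutions, hence simultaneously
diagonal with `±1` characters (`exists_jointSignBasis`); characters of `S_Λ ≤ 𝔽₂^{2n}` are restrictions of linear
functionals `⟨β_i, ·⟩`, `⟨α_j, ·⟩` (`exists_functional_of_character`); the lift equation conjugates to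
`B'(γ_s·x)_{ij} = χ¹_i(s) χ²_j(s) B'_{ij}` (`linSubst_conj_entry`) and `γ_s` scales `x_p` by `(-1)^{s(inl p₁)+s(inr p₂)}`,
so comparing the constant and the linear coefficients gives the two support clauses. [folklore] -/
theorem stub_signDiagonalise :
    ∀ (n m r : ℕ) (Λ : Fin r → (Fin n ⊕ Fin n) → ℤ) (B : Matrix (Fin m) (Fin m) (MvPolynomial (Fin n × Fin n) ℂ))
      (ρ₁ ρ₂ : ((Fin n ⊕ Fin n) → ZMod 2) → GL (Fin m) ℂ),
      (∀ i j, (B i j).totalDegree ≤ 1) →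
      ((∀ s ∈ {s : (Fin n ⊕ Fin n) → ZMod 2 | ∀ i, (∑ x, ((Λ i x : ℤ) : ZMod 2) * s x) = 0},
          ∀ t ∈ {s : (Fin n ⊕ Fin n) → ZMod 2 | ∀ i, (∑ x, ((Λ i x : ℤ) : ZMod 2) * s x) = 0},
            ρ₁ (s + t) = ρ₁ s * ρ₁ t ∧ ρ₂ (s + t) = ρ₂ s * ρ₂ t) ∧
        (∀ s ∈ {s : (Fin n ⊕ Fin n) → ZMod 2 | ∀ i, (∑ x, ((Λ i x : ℤ) : ZMod 2) * s x) = 0},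
          Matrix.linSubstEntries
              (Grenet.diagUnit
                (fun p : Fin n × Fin n =>
                  (if s (Sum.inl p.1) = 0 then (1 : ℂ) else -1) * (if s (Sum.inr p.2) = 0 then (1 : ℂ) else -1))
                (fun _ => mul_ne_zero (sgn_ne_zero _) (sgn_ne_zero _)))
              B =
            ((ρ₁ s : GL (Fin m) ℂ) : Matrix (Fin m) (Fin m) ℂ).map C * B *
              (((ρ₂ s)⁻¹ : GL (Fin m) ℂ) : Matrix (Fin m) (Fin m) ℂ).map C)) →
      ∃ (P Q : GL (Fin m) ℂ) (α β : Fin m → (Fin n ⊕ Fin n) → ZMod 2),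
        ∀ i j, ∃ (a₀ : ℂ) (a : Fin n × Fin n → ℂ),
          ((P : Matrix (Fin m) (Fin m) ℂ).map C * B * (Q : Matrix (Fin m) (Fin m) ℂ).map C :
              Matrix (Fin m) (Fin m) (MvPolynomial (Fin n × Fin n) ℂ)) i j
              = C a₀ + ∑ p, a p • X p ∧
          (a₀ ≠ 0 → ∀ s ∈ {s : (Fin n ⊕ Fin n) → ZMod 2 | ∀ i, (∑ x, ((Λ i x : ℤ) : ZMod 2) * s x) = 0},
              (∑ x, (β i - α j) x * s x) = 0) ∧
          (∀ p, a p ≠ 0 → ∀ s ∈ {s : (Fin n ⊕ Fin n) → ZMod 2 | ∀ i, (∑ x, ((Λ i x : ℤ) : ZMod 2) * s x) = 0},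
              (∑ x, (β i - α j - fun x => Sum.elim (fun k => if k = p.1 then (1 : ZMod 2) else 0)
                  (fun l => if l = p.2 then (1 : ZMod 2) else 0) x) x * s x) = 0) := by
  intro n m r Λ B ρ₁ ρ₂ hdeg hlift
  classical
  obtain ⟨hhom, hsub⟩ := hlift
  -- the sign group as a predicate
  set L : Fin r → (Fin n ⊕ Fin n) → ZMod 2 := fun i x => ((Λ i x : ℤ) : ZMod 2) with hL
  have memS : ∀ s : (Fin n ⊕ Fin n) → ZMod 2,
      s ∈ {s : (Fin n ⊕ Fin n) → ZMod 2 | ∀ i, (∑ x, ((Λ i x : ℤ) : ZMod 2) * s x) = 0} ↔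
        ∀ i, ∑ x, L i x * s x = 0 := fun s => Iff.rfl
  simp only [memS] at hhom hsub ⊢
  -- closure properties of the sign group
  have hS0 : ∀ i, ∑ x, L i x * (0 : (Fin n ⊕ Fin n) → ZMod 2) x = 0 := fun i => by simp
  have hSadd : ∀ s : (Fin n ⊕ Fin n) → ZMod 2, (∀ i, ∑ x, L i x * s x = 0) → ∀ t : (Fin n ⊕ Fin n) → ZMod 2, (∀ i, ∑ x, L i x * t x = 0) →
      ∀ i, ∑ x, L i x * (s + t) x = 0 := by
    intro s hs t ht i
    simp only [Pi.add_apply, mul_add, Finset.sum_add_distrib, hs i, ht i, add_zero]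
  have haa : ∀ a : ZMod 2, a + a = 0 := by decide
  have hss : ∀ s : (Fin n ⊕ Fin n) → ZMod 2, s + s = 0 := fun s => by
    funext x; exact haa (s x)
  -- involutions and commutation, for a homomorphic lift `ρ`
  have invol : ∀ ρ : ((Fin n ⊕ Fin n) → ZMod 2) → GL (Fin m) ℂ,
      (∀ s : (Fin n ⊕ Fin n) → ZMod 2, (∀ i, ∑ x, L i x * s x = 0) → ∀ t : (Fin n ⊕ Fin n) → ZMod 2, (∀ i, ∑ x, L i x * t x = 0) → ρ (s + t) = ρ s * ρ t) →
      (∀ s : (Fin n ⊕ Fin n) → ZMod 2, (∀ i, ∑ x, L i x * s x = 0) → ρ s * ρ s = 1) ∧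
      (∀ s : (Fin n ⊕ Fin n) → ZMod 2, (∀ i, ∑ x, L i x * s x = 0) → ∀ t : (Fin n ⊕ Fin n) → ZMod 2, (∀ i, ∑ x, L i x * t x = 0) → ρ s * ρ t = ρ t * ρ s) := by
    intro ρ hρ
    have h0 : ρ 0 = 1 := by
      have := hρ 0 hS0 0 hS0
      rw [add_zero] at this
      exact (mul_eq_left.mp this.symm)
    refine ⟨fun s hs => ?_, fun s hs t ht => ?_⟩
    · rw [← hρ s hs s hs, hss, h0]
    · rw [← hρ s hs t ht, ← hρ t ht s hs, add_comm]
  obtain ⟨hinv₁, hcomm₁⟩ := invol ρ₁ (fun s hs t ht => (hhom s hs t ht).1)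
  obtain ⟨hinv₂, hcomm₂⟩ := invol ρ₂ (fun s hs t ht => (hhom s hs t ht).2)
  -- joint sign bases for `ρ₁`, `ρ₂` on the subtype of the sign group
  let SΛ := {s : (Fin n ⊕ Fin n) → ZMod 2 // ∀ i, ∑ x, L i x * s x = 0}
  have basis_of : ∀ ρ : ((Fin n ⊕ Fin n) → ZMod 2) → GL (Fin m) ℂ,
      (∀ s : (Fin n ⊕ Fin n) → ZMod 2, (∀ i, ∑ x, L i x * s x = 0) → ρ s * ρ s = 1) →
      (∀ s : (Fin n ⊕ Fin n) → ZMod 2, (∀ i, ∑ x, L i x * s x = 0) → ∀ t : (Fin n ⊕ Fin n) → ZMod 2, (∀ i, ∑ x, L i x * t x = 0) → ρ s * ρ t = ρ t * ρ s) →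
      ∃ (P P' : Matrix (Fin m) (Fin m) ℂ) (χ : Fin m → SΛ → ℂ),
        P * P' = 1 ∧ P' * P = 1 ∧ (∀ i k, χ i k = 1 ∨ χ i k = -1) ∧
        ∀ k : SΛ, ((ρ k.1 : GL (Fin m) ℂ) : Matrix (Fin m) (Fin m) ℂ) = P * Matrix.diagonal (fun i => χ i k) * P' := by
    intro ρ hinv hcomm
    refine exists_jointSignBasis (fun k : SΛ => ((ρ k.1 : GL (Fin m) ℂ) : Matrix (Fin m) (Fin m) ℂ))
      (fun k => ?_) (fun k l => ?_)
    · rw [← Units.val_mul, hinv k.1 k.2, Units.val_one]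
    · rw [← Units.val_mul, ← Units.val_mul, hcomm k.1 k.2 l.1 l.2]
  obtain ⟨P₁, P₁', χ₁, hP₁, hP₁', hχ₁, hdiag₁⟩ := basis_of ρ₁ hinv₁ hcomm₁
  obtain ⟨P₂, P₂', χ₂, hP₂, hP₂', hχ₂, hdiag₂⟩ := basis_of ρ₂ hinv₂ hcomm₂
  -- multiplicativity of the characters
  have charmul : ∀ (ρ : ((Fin n ⊕ Fin n) → ZMod 2) → GL (Fin m) ℂ) (P P' : Matrix (Fin m) (Fin m) ℂ)
      (χ : Fin m → SΛ → ℂ), P * P' = 1 → P' * P = 1 →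
      (∀ s : (Fin n ⊕ Fin n) → ZMod 2, (∀ i, ∑ x, L i x * s x = 0) → ∀ t : (Fin n ⊕ Fin n) → ZMod 2, (∀ i, ∑ x, L i x * t x = 0) → ρ (s + t) = ρ s * ρ t) →
      (∀ k : SΛ, ((ρ k.1 : GL (Fin m) ℂ) : Matrix (Fin m) (Fin m) ℂ) = P * Matrix.diagonal (fun i => χ i k) * P') →
      ∀ (i : Fin m) (s t : SΛ), χ i ⟨s.1 + t.1, hSadd s.1 s.2 t.1 t.2⟩ = χ i s * χ i t := by
    intro ρ P P' χ hP hP' hρ hd i s t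
    have h := congrArg (fun u : GL (Fin m) ℂ => (u : Matrix (Fin m) (Fin m) ℂ)) (hρ s.1 s.2 t.1 t.2)
    simp only [Units.val_mul] at h
    rw [hd ⟨s.1 + t.1, hSadd s.1 s.2 t.1 t.2⟩, hd s, hd t] at h
    -- cancel `P` on the left and `P'` on the right
    have h2 : Matrix.diagonal (fun i => χ i ⟨s.1 + t.1, hSadd s.1 s.2 t.1 t.2⟩) =
        Matrix.diagonal (fun i => χ i s) * Matrix.diagonal (fun i => χ i t) := by
      have := congrArg (fun M => P' * M * P) h
      have lhs : P' * (P * Matrix.diagonal (fun i => χ i ⟨s.1 + t.1, hSadd s.1 s.2 t.1 t.2⟩) * P') * P =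
          Matrix.diagonal (fun i => χ i ⟨s.1 + t.1, hSadd s.1 s.2 t.1 t.2⟩) := by
        rw [← Matrix.mul_assoc, ← Matrix.mul_assoc, hP', Matrix.one_mul, Matrix.mul_assoc, hP', Matrix.mul_one]
      have rhs : P' * (P * Matrix.diagonal (fun i => χ i s) * P' * (P * Matrix.diagonal (fun i => χ i t) * P')) * P =
          Matrix.diagonal (fun i => χ i s) * Matrix.diagonal (fun i => χ i t) := by
        calc P' * (P * Matrix.diagonal (fun i => χ i s) * P' * (P * Matrix.diagonal (fun i => χ i t) * P')) * P
            = (P' * P) * Matrix.diagonal (fun i => χ i s) * (P' * P) * Matrix.diagonal (fun i => χ i t) * (P' * P) := by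
              simp only [Matrix.mul_assoc]
          _ = Matrix.diagonal (fun i => χ i s) * Matrix.diagonal (fun i => χ i t) := by
              rw [hP', Matrix.one_mul, Matrix.mul_one, Matrix.mul_one]
      rw [lhs, rhs] at this
      exact this
    rw [Matrix.diagonal_mul_diagonal] at h2
    have := congr_fun (Matrix.diagonal_injective h2) i
    simpa using this
  -- extend each character to a linear functional
  have functional : ∀ (χ : Fin m → SΛ → ℂ), (∀ i k, χ i k = 1 ∨ χ i k = -1) →
      (∀ (i : Fin m) (s t : SΛ), χ i ⟨s.1 + t.1, hSadd s.1 s.2 t.1 t.2⟩ = χ i s * χ i t) →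
      ∀ i, ∃ β : (Fin n ⊕ Fin n) → ZMod 2, ∀ k : SΛ, χ i k = if (∑ x, β x * k.1 x) = 0 then (1 : ℂ) else -1 := by
    intro χ hv hm i
    let χ' : ((Fin n ⊕ Fin n) → ZMod 2) → ℂ := fun s => if h : ∀ i', ∑ x, L i' x * s x = 0 then χ i ⟨s, h⟩ else 1
    have hχ' : ∀ k : SΛ, χ' k.1 = χ i k := fun k => by
      show (if h : ∀ i', ∑ x, L i' x * k.1 x = 0 then χ i ⟨k.1, h⟩ else 1) = χ i k
      rw [dif_pos k.2]
    obtain ⟨β, hβ⟩ := exists_functional_of_character L χ'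
      (fun s hs t ht => by
        rw [hχ' ⟨s, hs⟩, hχ' ⟨t, ht⟩, ← hm i ⟨s, hs⟩ ⟨t, ht⟩, ← hχ' ⟨s + t, hSadd s hs t ht⟩])
      (fun s hs => by rw [hχ' ⟨s, hs⟩]; exact hv i ⟨s, hs⟩)
    exact ⟨β, fun k => by rw [← hχ' k]; exact hβ k.1 k.2⟩
  choose β hβ using functional χ₁ hχ₁ (charmul ρ₁ P₁ P₁' χ₁ hP₁ hP₁' (fun s hs t ht => (hhom s hs t ht).1) hdiag₁)
  choose α hα using functional χ₂ hχ₂ (charmul ρ₂ P₂ P₂' χ₂ hP₂ hP₂' (fun s hs t ht => (hhom s hs t ht).2) hdiag₂)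
  -- the base change: `P := P₁'` (inverse `P₁`), `Q := P₂` (inverse `P₂'`)
  refine ⟨⟨P₁', P₁, hP₁', hP₁⟩, ⟨P₂, P₂', hP₂, hP₂'⟩, α, β, fun i j => ?_⟩
  set B' : Matrix (Fin m) (Fin m) (MvPolynomial (Fin n × Fin n) ℂ) := P₁'.map C * B * P₂.map C with hB'
  have hdeg' : (B' i j).totalDegree ≤ 1 := totalDegree_conj_le_one P₁' P₂ B hdeg i j
  -- the scaling equation `B'(γ_s · x)_{ij} = χ¹_i(s) χ²_j(s) · B'_{ij}` for every `s ∈ S_Λ`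
  have key : ∀ (s : (Fin n ⊕ Fin n) → ZMod 2) (hs : ∀ i', ∑ x, L i' x * s x = 0),
      linSubst (Fin n × Fin n) ℂ
          (Matrix.diagonal fun p : Fin n × Fin n =>
            (if s (Sum.inl p.1) = 0 then (1 : ℂ) else -1) * (if s (Sum.inr p.2) = 0 then (1 : ℂ) else -1))
          (B' i j) =
        (χ₁ i ⟨s, hs⟩ * χ₂ j ⟨s, hs⟩) • B' i j := by
    intro s hs
    have h := hsub s hs
    have hinv : (ρ₂ s)⁻¹ = ρ₂ s := inv_eq_of_mul_eq_one_right (hinv₂ s hs)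
    have h1 : ((ρ₁ s : GL (Fin m) ℂ) : Matrix (Fin m) (Fin m) ℂ) =
        P₁ * Matrix.diagonal (fun i => χ₁ i ⟨s, hs⟩) * P₁' := hdiag₁ ⟨s, hs⟩
    have h2 : ((ρ₂ s : GL (Fin m) ℂ) : Matrix (Fin m) (Fin m) ℂ) =
        P₂ * Matrix.diagonal (fun i => χ₂ i ⟨s, hs⟩) * P₂' := hdiag₂ ⟨s, hs⟩
    rw [hinv, h1, h2] at h
    have h3 := linSubst_conj_entry _ B P₁ P₁' P₂ P₂' hP₁' hP₂' _ _ h i j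
    rw [Grenet.val_diagUnit] at h3
    exact h3
  refine ⟨coeff 0 (B' i j), fun p => coeff (Finsupp.single p 1) (B' i j),
    eq_C_add_sum_smul_X_of_totalDegree_le_one hdeg', ?_, ?_⟩
  · -- constant coefficient: `a₀ = χ¹χ² a₀`, so `a₀ ≠ 0` forces `⟨β_i + α_j, s⟩ = 0`
    intro ha₀ s hs
    have e := congrArg (coeff 0) (key s hs)
    rw [coeff_zero_linSubst_diagonal, coeff_smul, smul_eq_mul] at e
    have hl : χ₁ i ⟨s, hs⟩ * χ₂ j ⟨s, hs⟩ = 1 := (mul_eq_right₀ ha₀).mp e.symm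
    rw [hβ i ⟨s, hs⟩, hα j ⟨s, hs⟩, ← sgn_add] at hl
    have h0 := (sgn_eq_one_iff _).mp hl
    rw [pair_sub]
    exact h0
  · -- linear coefficients: `c_p a_p = χ¹χ² a_p`, so `a_p ≠ 0` forces `⟨varVec p, s⟩ = ⟨β_i + α_j, s⟩`
    intro p hap s hs
    have e := congrArg (coeff (Finsupp.single p 1)) (key s hs)
    rw [coeff_single_linSubst_diagonal, coeff_smul, smul_eq_mul] at e
    have hl := mul_right_cancel₀ hap e
    rw [hβ i ⟨s, hs⟩, hα j ⟨s, hs⟩, ← sgn_add, ← sgn_add] at hl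
    have h0 := sgn_inj hl
    rw [pair_sub, pair_sub, pair_varVec, h0]
    exact haa _

end Main

end Summit.ValiantsHypothesis.ValiantsHypothesis.Theorems.FreeSubtorusOrbitDimensionBound.SignCovering
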